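import Summits.BirchSwinnertonDyer.BirchSwinnertonDyer.Theorems.UniversalToricDescentToricTransportModThreeTwinMuZero
import Literature.NumberTheory.EllipticCurves.Hsieh2014.AnticyclotomicMuInvariantAnyLevel
import HarnessLib

/-!
# `TwinMuZeroAtThree` (stmt-BirchSwinnertonDyer-20400) BY NAME from the route's OWN print item
# `TwinHsiehThmBInput` (stmt-BirchSwinnertonDyer-27933 = PUB 20711, Hsieh 2014 Thm. B at any level)

Width prover `bsd-wall-utd-p1-w2` g7 under LEAD `bsd-wall-utd-p1` g20 (`--supports stmt-BirchSwinnertonDyer-20400`). This is the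
«3-line Theorems file to land» of vet-utdR3 g1's VERDICT 2/2 (STATUS 2026-08-29T14:45:25Z, evidence #3 on 20400,
`VET-UTDR3-g1-B.md` 6727fb31c9badcb4; kernel-checked there as `HOME/bsd-vet-utdR3/g1/CH.lean` `live20400_of_item27933`): the
open support 20400 — analytic `μ = 0` for every frame of the twin `E′` (all three twin buckets, any Heegner `K`) — is CLOSED MODULO
ONE PUBLISHED NAMED FACT already displayed on this route as an item: 27933 `TwinHsiehThmBInput` :=
`Hsieh2014.thmB_exists_isHsiehLFunction_coeff_norm_eq_one_unrPeriod_anyLevel` ⟹ (Literature bookkeeping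
`Hsieh2014.thmB_exists_isHsiehLFunction_coeff_norm_eq_one_of_anyLevel`) the base Thm. B fact (`p ≠ 2`, `v_p(N) ≤ 1` — so the
multiplicative `3 ∥ N′` bucket B IS covered) ⟹ LEAD utd-p1 g3's `…UniversalToricDescentTwinMuZero.twinMuZeroAtThree_of_thmB`
(p540587, 2026-08-27). Consequence for the pen's RK-7 (v2-with-B vs the vet's v3-without-B, director's call): under v3 the `closes`
term takes ONE displayed binder `hThmB : TwinHsiehThmBInput` and derives `hTμ : TwinMuZeroAtThree := twinMuZeroAtThree_of_twinHsiehThmBInput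
hThmB` inside, kernels hK 22543 / hKr 24256 UNCHANGED; under v2 this file is the certificate that the B item is «closed modulo print
(Hsieh Thm. B by name)», never research. THEOREMS ONLY; std axioms; no `sorry`. HONEST FRAMING: an implication between two route
items; CONDITIONAL on the print input 27933 (Hsieh 2014 Thm. B as typed in the tree, incl. its use at a Steinberg prime `3 ∥ N′` —
the vet flags a LITERATURE AUDIT of that joint as the honest follow-up, not a `μ` research crux); BSD is proved for no curve by this.
References: [Hsieh2014] M.-L. Hsieh, Doc. Math. 19 (2014), Thm. B; [Castella2018] Thm. 3.1.
-/

set_option linter.dupNamespace false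
set_option autoImplicit false

namespace Summit.BirchSwinnertonDyer.BirchSwinnertonDyer.Theorems.UniversalToricDescentTwinMuZero

open Summit.BirchSwinnertonDyer.BirchSwinnertonDyer.Theses.UniversalToricDescent

/-- **20400 `TwinMuZeroAtThree` ⟸ 27933 `TwinHsiehThmBInput`, BY NAME** (= vet-utdR3 g1's `live20400_of_item27933`): Hsieh
Thm. B at any level with `Ω_p ∈ R₀ˣ` ⟹ the base Thm. B fact (`…_of_anyLevel`) ⟹ `twinMuZeroAtThree_of_thmB` (p540587). The RK-7 v3
`closes` derives its `hTμ` from the displayed binder `hThmB` by this term. CONDITIONAL on 27933; BSD is proved for no curve by this.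
[cite: Hsieh2014, Thm. B (Doc. Math. 19 p. 713)] -/
theorem twinMuZeroAtThree_of_twinHsiehThmBInput (hThmB : TwinHsiehThmBInput) : TwinMuZeroAtThree :=
  twinMuZeroAtThree_of_thmB
    (Literature.NumberTheory.EllipticCurves.Hsieh2014.thmB_exists_isHsiehLFunction_coeff_norm_eq_one_of_anyLevel hThmB)

/-- **… and the RK-7 v2 B residue `TwinMuZeroAtThreeMultOdd` (pen sketch text, 1989 characters, VERBATIM) ⟸ 27933**, so that IF the
B item is filed it closes by `fun hThmB ↦ twinMuZeroAtThreeMultOdd_of_twinHsiehThmBInput hThmB` — «closed modulo print», not research.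
CONDITIONAL on 27933; BSD is proved for no curve by this. [cite: Hsieh2014, Thm. B (Doc. Math. 19 p. 713)] -/
theorem twinMuZeroAtThreeMultOdd_of_twinHsiehThmBInput (hThmB : TwinHsiehThmBInput) :
    ∀ (W : WeierstrassCurve ℚ) [W.IsElliptic] [W.IsGloballyMinimal] (W' : WeierstrassCurve ℚ) [W'.IsElliptic] [W'.IsGloballyMinimal] (N N' : ℕ) [NeZero N] [NeZero N'] (K : Type) [Field K] [NumberField K] (Dt : Literature.NumberTheory.EllipticCurves.ModularForms.ModularParametrizationData W N) (Dt' : Literature.NumberTheory.EllipticCurves.ModularForms.ModularParametrizationData W' N'), Summit.BirchSwinnertonDyer.Rank1Residual.Additive.ClassO6 W 3 → W.HasSurjectiveModNGaloisRep 3 → W.analyticRank = 1 → W.conductorNorm ℤ = N → Summit.BirchSwinnertonDyer.Rank1Residual.O6.ModPCongruent W' W 3 → ¬ Literature.NumberTheory.EllipticCurves.Rank1Residual.Addv W' 3 → W'.conductorNorm ℤ = N' → Literature.NumberTheory.EllipticCurves.IsImaginaryQuadratic K → Literature.NumberTheory.EllipticCurves.SatisfiesHeegnerHypothesis N K → Literature.NumberTheory.EllipticCurves.SatisfiesHeegnerHypothesis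 N' K → Odd (NumberField.discr K) → (Literature.NumberTheory.EllipticCurves.Rank1Residual.Mult W' 3 ∧ ¬ 3 ∣ padicValInt 3 W'.minimalDiscriminantInt) → ∀ (κ : Literature.NumberTheory.EllipticCurves.ZpExtension K 3), κ.IsAnticyclotomic → ∀ (γ : Field.absoluteGaloisGroup K) [Fact (κ.IsTopGenerator γ)] (𝔭 : IsDedekindDomain.HeightOneSpectrum (NumberField.RingOfIntegers K)), ((3 : ℕ) : NumberField.RingOfIntegers K) ∈ 𝔭.asIdeal → 𝔭.asIdeal.ramificationIdx (NumberField.RingOfIntegers ℚ) = 1 → 𝔭.asIdeal.inertiaDeg (NumberField.RingOfIntegers ℚ) = 1 → ∀ (𝔭' : IsDedekindDomain.HeightOneSpectrum (NumberField.RingOfIntegers K)), ((3 : ℕ) : NumberField.RingOfIntegers K) ∈ 𝔭'.asIdeal → 𝔭' ≠ 𝔭 → ∀ (ι' : PadicAlgCl 3 ≃+* ℂ), Summit.BirchSwinnertonDyer.BirchSwinnertonDyer.Theorems.SchneiderFree.BranchInducesPrime 3 ι' 𝔭 → ∀ (ΩK : ℂ) (Ωp : ℂ_[3]) (L' : Literature.NumberTheory.EllipticCurves.UnrSeries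 3), ΩK ≠ 0 → Ωp ≠ 0 → Literature.NumberTheory.EllipticCurves.IsBDPLFunction ι' 𝔭 κ γ Dt'.f ΩK Ωp L' → ∃ i : ℕ, ‖((PowerSeries.coeff i L' : Literature.NumberTheory.EllipticCurves.unrIntegers 3) : ℂ_[3])‖ = 1 := by
  intro W _ _ W' _ _ N N' _ _ K _ _ Dt Dt' hO6 hsurj hrk hN hcong hAddv hN' hK hH hH' _ _
  exact twinMuZeroAtThree_of_twinHsiehThmBInput hThmB W W' N N' K Dt Dt' hO6 hsurj hrk hN hcong hAddv hN' hK hH hH'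

end Summit.BirchSwinnertonDyer.BirchSwinnertonDyer.Theorems.UniversalToricDescentTwinMuZero
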